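import Summits.NavierStokesRegularity.NavierStokesRegularity.Theses.AngularGalerkinLadder
import Summits.NavierStokesRegularity.NavierStokesRegularity.Theorems.NoOverheating.Negative.LadderLimitExposed
import Summits.NavierStokesRegularity.NavierStokesRegularity.Theorems.NoOverheating.Negative.AsymptoticSymmetryWindowsExcluded
import HarnessLib

/-!
# KJ-68 — ROTATING WAVES / rigidly co-moving profiles (relative equilibria under ANY path of
# linear isometries) are excluded, exactly and asymptotically (route `AngularGalerkinLadder`,
# cruxes K1 `RungBlowupCofinal` / K2 `NoOverheating`; refuter lineage, Negative lane)

Stratum (S28), the time-MOVING enlargement of the steady stratum (S11b)/(S20): a field whose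
slice NORM is steady in a rigidly moving frame, `‖v(s, g(s) x)‖ = ‖v(t, g(t) x)‖` for all
`s, t < 0` and one (arbitrary, not even continuous) path `g : ℝ → (E³ ≃ₗᵢ E³)` of linear
isometries
— uniformly rotating waves `v(t, x) = Q(t) V(Q(t)ᵀ x)`, precessing or tumbling profiles,
steady profiles (`g ≡ id`) — and which has Type-I decay `‖v(t, x)‖ ≤ C/(‖x‖ + √(−t))`
VANISHES on the past
(`eq_zero_of_normCoMoving_of_hasTypeIDecay`: the co-moving norm `‖v(t, g(t) x)‖ • e₀` is a STEADY
field with the same Type-I constant, since `‖g(t) x‖ = ‖x‖`, and steady Type-I fields vanish,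
`…AsymptoticSymmetryExcluded.eq_zero_of_steady_of_hasTypeIDecay`, KJ-58).  Hence

* PROFILE-level (any `C₀`, rotation, factor): no `RungIsSingular` witness and no window profile is
  a rotating wave / rigidly co-moving (`rungProfile_eq_zero_of_normCoMoving`,
  `rungProfile_eq_zero_of_rotatingWave`, `not_nontrivial_rungProfile_of_normCoMoving`,
  `no_windowProfile_normCoMoving`);
* SEQUENCE-level (any `C₀`, rotations, window): no admissible window sequence is ASYMPTOTICALLY
  rigidly co-moving along a fixed isometry path `g`,
  `‖uₙ(s, g(s) x)‖ − ‖uₙ(t, g(t) x)‖ → 0` (`no_windowSequence_asymptoticallyNormCoMoving`): the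
  Type-I ladder limit (`exists_ladderLimit_typeI`; slice-wise pointwise convergence suffices since
  the points `g(t) x` do not depend on `n`) would be co-moving, hence zero, against its floor.

READING FOR THE CIRCUIT: letting the supply ROTATE rigidly in time (the natural "angular" relative
equilibrium) buys nothing — Type-I decay alone kills every rigidly co-moving norm pattern.
No `kit`.
[cite: KochNadirashviliSereginSverak2009, Lemma 6.1 (limits of rescaled solutions)] -/

namespace Summit.NavierStokesRegularity.AngularGalerkinLadderRotatingWaveProfilesExcluded

open Set Filter MeasureTheory Topology Function
open Literature.Analysis Literature.Analysis.FluidPDE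
open Summit.NavierStokesRegularity.FluidComputer
open Summit.NavierStokesRegularity.FluidComputer.AngularLadder
open Summit.NavierStokesRegularity.NavierStokesRegularity.Theses.AngularGalerkinLadder
open Summit.NavierStokesRegularity.AngularGalerkinLadderLadderLimit
open Summit.NavierStokesRegularity.AngularGalerkinLadderAsymptoticSymmetryExcluded

/-! ## §1 Co-moving norm + Type-I decay ⇒ zero -/

/-- **A Type-I field whose slice norm is steady in a rigidly moving frame vanishes.**  If
`‖v(s, g(s) x)‖ = ‖v(t, g(t) x)‖` for all `s, t < 0`, `x`, along a path `g` of linear isometries,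
and
`‖v(t, x)‖ ≤ C/(‖x‖ + √(−t))`, then `v ≡ 0` on the past: the field `(t, x) ↦ ‖v(t, g(t) x)‖ • e₀`
(`‖e₀‖ = 1`) is steady with Type-I constant `C` (`‖g(t) x‖ = ‖x‖`), so it vanishes by
`eq_zero_of_steady_of_hasTypeIDecay`, and `g(t)` is onto. [folklore] -/
theorem eq_zero_of_normCoMoving_of_hasTypeIDecay
    {v : ℝ → EuclideanSpace ℝ (Fin 3) → EuclideanSpace ℝ (Fin 3)} {C : ℝ} (hTI : HasTypeIDecay C v)
    (g : ℝ → (EuclideanSpace ℝ (Fin 3) ≃ₗᵢ[ℝ] EuclideanSpace ℝ (Fin 3)))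
    (hco : ∀ s < 0, ∀ t < 0, ∀ x, ‖v s (g s x)‖ = ‖v t (g t x)‖) : ∀ t < 0, ∀ x, v t x = 0 := by
  set e₀ : EuclideanSpace ℝ (Fin 3) := EuclideanSpace.single 0 1 with he₀
  have hne : ‖e₀‖ = 1 := by simp [he₀]
  set w : ℝ → EuclideanSpace ℝ (Fin 3) → EuclideanSpace ℝ (Fin 3) :=
    fun t x => ‖v t (g t x)‖ • e₀ with hw
  have hwn : ∀ t x, ‖w t x‖ = ‖v t (g t x)‖ := fun t x => by
    rw [hw, norm_smul, norm_norm, hne, mul_one]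
  have hwTI : HasTypeIDecay C w := fun t ht x => by
    rw [hwn, ← (g t).norm_map x]
    exact hTI t ht (g t x)
  have hwst : ∀ s < 0, ∀ t < 0, ∀ x, w s x = w t x := fun s hs t ht x => by
    simp only [hw, hco s hs t ht x]
  have hz := eq_zero_of_steady_of_hasTypeIDecay hwTI hwst
  intro t ht x
  have h1 : ‖v t (g t ((g t).symm x))‖ = 0 := by rw [← hwn, hz t ht, norm_zero]
  rwa [LinearIsometryEquiv.apply_symm_apply, norm_eq_zero] at h1

/-! ## §2 (S28) PROFILE-level: no rotating waves / rigidly co-moving rung profiles -/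

section Profile

variable {L : ℕ} {C₀ c : ℝ} {R : EuclideanSpace ℝ (Fin 3) ≃ₗᵢ[ℝ] EuclideanSpace ℝ (Fin 3)}
  {u : ℝ → EuclideanSpace ℝ (Fin 3) → EuclideanSpace ℝ (Fin 3)}
  {p : ℝ → EuclideanSpace ℝ (Fin 3) → ℝ}
  {d : ℝ → EuclideanSpace ℝ (Fin 3) → EuclideanSpace ℝ (Fin 3)}

/-- **(S28) A rigidly co-moving rung profile vanishes on the past** — ANY `C₀`, ANY rotation `R`,
ANY factor, ANY isometry path `g`. -/
theorem rungProfile_eq_zero_of_normCoMoving (hP : IsRungProfile L C₀ c R u p d)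
    (g : ℝ → (EuclideanSpace ℝ (Fin 3) ≃ₗᵢ[ℝ] EuclideanSpace ℝ (Fin 3)))
    (hco : ∀ s < 0, ∀ t < 0, ∀ x, ‖u s (g s x)‖ = ‖u t (g t x)‖) : ∀ t < 0, ∀ x, u t x = 0 :=
  eq_zero_of_normCoMoving_of_hasTypeIDecay hP.hasTypeIDecay g hco

/-- **(S28) Rotating waves**: a rung profile of the form `u(t, g(t) x) = U(x)` on the past — e.g.
`u(t, x) = Q(t) V(Q(t)ᵀ x)` up to the frame's action on values, which the norm does not see —
vanishes on the past. -/
theorem rungProfile_eq_zero_of_rotatingWave (hP : IsRungProfile L C₀ c R u p d)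
    (g : ℝ → (EuclideanSpace ℝ (Fin 3) ≃ₗᵢ[ℝ] EuclideanSpace ℝ (Fin 3)))
    {U : EuclideanSpace ℝ (Fin 3) → EuclideanSpace ℝ (Fin 3)}
    (hrw : ∀ t < 0, ∀ x, ‖u t (g t x)‖ = ‖U x‖) : ∀ t < 0, ∀ x, u t x = 0 :=
  rungProfile_eq_zero_of_normCoMoving hP g fun s hs t ht x => by rw [hrw s hs, hrw t ht]

/-- **(S28) for K1's witnesses**: a rigidly co-moving rung profile is not a `RungIsSingular`
witness. -/
theorem not_nontrivial_rungProfile_of_normCoMoving (hP : IsRungProfile L C₀ c R u p d)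
    (g : ℝ → (EuclideanSpace ℝ (Fin 3) ≃ₗᵢ[ℝ] EuclideanSpace ℝ (Fin 3)))
    (hco : ∀ s < 0, ∀ t < 0, ∀ x, ‖u s (g s x)‖ = ‖u t (g t x)‖) : ¬ ∃ t < 0, ∃ x, u t x ≠ 0 :=
  fun ⟨t, ht, x, hx⟩ => hx (rungProfile_eq_zero_of_normCoMoving hP g hco t ht x)

/-- **(S28) for K2's windows**: no window profile (`0 < δ`) is rigidly co-moving — ANY `C₀`, ANY
window, ANY rotation, ANY isometry path. -/
theorem no_windowProfile_normCoMoving {cmin cmax δ ε : ℝ} (hδ : 0 < δ)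
    (hW : IsWindowProfile L C₀ cmin cmax δ ε c R u p d)
    (g : ℝ → (EuclideanSpace ℝ (Fin 3) ≃ₗᵢ[ℝ] EuclideanSpace ℝ (Fin 3)))
    (hco : ∀ s < 0, ∀ t < 0, ∀ x, ‖u s (g s x)‖ = ‖u t (g t x)‖) : False := by
  obtain ⟨hP, -, -, ⟨x₀, hx₀⟩, -⟩ := hW
  rw [rungProfile_eq_zero_of_normCoMoving hP g hco (-1) (by norm_num) x₀, norm_zero] at hx₀
  exact absurd hx₀ (not_le.2 hδ)

end Profile

/-! ## §3 (S28) SEQUENCE-level: no asymptotically co-moving window sequences -/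

variable {C₀ cmin cmax δ : ℝ} {L : ℕ → ℕ} {ε c : ℕ → ℝ}
  {R : ℕ → (EuclideanSpace ℝ (Fin 3) ≃ₗᵢ[ℝ] EuclideanSpace ℝ (Fin 3))}
  {u : ℕ → ℝ → EuclideanSpace ℝ (Fin 3) → EuclideanSpace ℝ (Fin 3)}
  {p : ℕ → ℝ → EuclideanSpace ℝ (Fin 3) → ℝ}
  {d : ℕ → ℝ → EuclideanSpace ℝ (Fin 3) → EuclideanSpace ℝ (Fin 3)}

/-- **(S28) No admissible window sequence is asymptotically rigidly co-moving.**  `1 < cmin`,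
`0 < δ`, `εₙ → 0`, window rung profiles with constant `C₀` — ANY `C₀`, ANY rotations, ANY window —
and, along one isometry path `g`, `‖uₙ(s, g(s) x)‖ − ‖uₙ(t, g(t) x)‖ → 0` for all `s, t < 0`, `x`,
are contradictory: the Type-I ladder limit is rigidly co-moving along `g`, hence zero on the past,
against its inherited floor `δ ≤ ‖v(−1, x₀)‖`.
[cite: KochNadirashviliSereginSverak2009, Lemma 6.1 (limits of rescaled solutions)] -/
theorem no_windowSequence_asymptoticallyNormCoMoving (hcmin : 1 < cmin) (hδ : 0 < δ)
    (hε : Tendsto ε atTop (𝓝 0))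
    (hW : ∀ n, IsWindowProfile (L n) C₀ cmin cmax δ (ε n) (c n) (R n) (u n) (p n) (d n))
    (g : ℝ → (EuclideanSpace ℝ (Fin 3) ≃ₗᵢ[ℝ] EuclideanSpace ℝ (Fin 3)))
    (hdef : ∀ s < 0, ∀ t < 0, ∀ x,
      Tendsto (fun n => ‖u n s (g s x)‖ - ‖u n t (g t x)‖) atTop (𝓝 0)) : False := by
  obtain ⟨φ, c', R', v, hφ, -, -, -, hptw, -, -, -, -, -, -, hTI, ⟨x₀, hx₀⟩, -⟩ :=
    exists_ladderLimit_typeI hcmin hδ hε hW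
  have hco : ∀ s < 0, ∀ t < 0, ∀ x, ‖v s (g s x)‖ = ‖v t (g t x)‖ := by
    intro s hs t ht x
    have h1 : Tendsto (fun n => ‖u (φ n) s (g s x)‖ - ‖u (φ n) t (g t x)‖) atTop
        (𝓝 (‖v s (g s x)‖ - ‖v t (g t x)‖)) :=
      ((hptw s hs (g s x)).norm).sub ((hptw t ht (g t x)).norm)
    exact sub_eq_zero.1 (tendsto_nhds_unique h1 ((hdef s hs t ht x).comp hφ.tendsto_atTop))
  have hz := eq_zero_of_normCoMoving_of_hasTypeIDecay hTI g hco
  rw [hz (-1) (by norm_num) x₀, norm_zero] at hx₀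
  exact absurd hx₀ (not_le.2 hδ)

/-- **(S28) in census form.** -/
theorem no_windowSequence_asymptoticallyNormCoMoving_census (hcmin : 1 < cmin) (hδ : 0 < δ)
    (hε : Tendsto ε atTop (𝓝 0))
    (hW : ∀ n, IsWindowProfile (L n) C₀ cmin cmax δ (ε n) (c n) (R n) (u n) (p n) (d n)) :
    ¬ ∃ g : ℝ → (EuclideanSpace ℝ (Fin 3) ≃ₗᵢ[ℝ] EuclideanSpace ℝ (Fin 3)), ∀ s < 0, ∀ t < 0, ∀ x,
        Tendsto (fun n => ‖u n s (g s x)‖ - ‖u n t (g t x)‖) atTop (𝓝 0) :=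
  fun ⟨g, hdef⟩ => no_windowSequence_asymptoticallyNormCoMoving hcmin hδ hε hW g hdef

end Summit.NavierStokesRegularity.AngularGalerkinLadderRotatingWaveProfilesExcluded
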